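import Summits.BirchSwinnertonDyer.BirchSwinnertonDyer.Theorems.EdixhovenFibreFiveSevenStarredOptimalManinUnitFiveSevenTransportedReciprocity
import Literature.NumberTheory.PAdicHodge.PadicLogCurveFOChart
import Literature.NumberTheory.PAdicHodge.ReciprocityFormulaOffLevel
import HarnessLib

/-!
# Kato's explicit reciprocity law at ALL points of `E(K_v)` for a RAMIFIED good supersingular model `W_D ≡ E₀ (mod ϖ)`, in the
# currency `⟨[η], P⟩ = Tr_{F/ℚ_p}(c · exp*_d(η) · log_ω P)` — the OFF-LEVEL upgrade of `…TransportedReciprocity`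

Cell `pub/bsd-wall`, D-0145 line `route-BirchSwinnertonDyer-EdixhovenFibreFiveSeven`, seat `bsd-line-edix-p4` (gen 28); crux K★
`stmt-BirchSwinnertonDyer-22226` (`StarredOptimalManinUnitFiveSeven`), line `kato_lever`, memos `Cruxes/StarredOptimalManinUnitFiveSeven/Lines/
kato-lever-K2-transported-capstone.md` §2 (items 2–3) and `…/kato-lever-seam-rec-at-cells.md` §3 («off-level upgrade»). THEOREMS ONLY (no definition,
no named fact, no instance, no `sorry`); helper `--supports stmt-BirchSwinnertonDyer-22226`. **BSD is not proved by this file, and neither is K★ or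
[REC-tower]**: it upgrades Kato's formula for ONE ramified good supersingular `𝒪_D`-model `E = curveFO F (W_D ⊗_ψ 𝒪_F)` at the completion `F = K_v` from the
deep formal points (T5-C, `TransportedReciprocity.exists_const_tatePairingPoint_eq_neg_trace_of_omegaPeriod_ne_zero`, where the scalar `c_P` is a free
parameter tied to the parameter `z(P)` by the series `p^N·Σ'[Xʲ]log_{W_D}·z(P)ʲ`) to **every `P ∈ E(F)` with `log_ω(P) = padicLogPointFiniteExt w E p P`**
(any valuation `w` of `F` compatible with its valuative structure) — the shape of the hypothesis `hrec'` of
`…ReciprocityTowerFromAbove.exists_const_tower_clauses_of_formula_above` (up to the model/curve transport `E ≅ W_min ⊗ K'`, not done here).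

THE ASSEMBLY (`exists_const_tatePairingPoint_eq_trace_mul_padicLog`). Same inputs as T5-C (cell data of the socket, `E₀/ℤ` good supersingular at
`p ≥ 5` with `W_D ≡ E₀ (mod ϖ)`, an index `N ≥ e`, (N1′) `∫_τ ω_{W_D} ≠ 0` for some `τ`), plus a compatible valuation `w`. Steps:
(1) on the level `E⁽ᵖ⁾(F) = {Q ∈ E₁(F) : |z(Q)|_w ≤ |p|_w}`: a `p`-power division sequence of `Q` in `E(F̄)` (`AinfTop.exists_divSeqO`), its image in
`E(ℂ_F)` is formal (`AinfTop.geomToCO_toGeomPoints_mem_kernel`) of depth `‖z‖^N ≤ ‖p‖` (`AinfTop.norm_zCoord_geomToCO_toGeomPoints_pow_le`, `N ≥ e ≥ 1`),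
and THE CHART `ι_F(p^N·log_ω Q) = p^N·Σ'[Xʲ]log_{W_D}·z(ι Q)ʲ` (`AinfTop.algebraMap_pow_mul_padicLogPointFiniteExt_curveFO_eq`: functoriality `F → ℂ_F` of
`log_ω` on the level + `FormalLogValuesIntegralCoeffChart` + `W_D ⊗_{𝒪_D} ℂ_F = E ⊗ ℂ_F`) discharge every per-point hypothesis of T5-C with
`c_Q := p^N·log_ω(Q)`; (2) off the level: `⟨[η], ·⟩` is additive (`tatePairingPoint` is a bi-additive hom), every `P ∈ E(F)` has a positive multiple in
the level (`FormalGroupChart.exists_nsmul_mem_level_of_isNonarchimedeanLocalField`), and `log_ω(m•P) = m·log_ω(P)`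
(`ReciprocityFormulaOffLevel.eq_neg_trace_mul_of_forall_level`).

What a K★ cell must still supply (unchanged from T5-C, minus the chart and the index step done here): its instances (`W_D = ⟨0,0,0,a·ϖ^{r₄},b·ϖ^{r₆}⟩`,
`E₀`, `p ∈ {5,7}`, `map_explicitModel_eq_map_cmFibre`), (N1′) (tree), the Weil tower / `ψ` / de Rham binders of the socket, the transport of the formula
along `E ≅ W_min ⊗ K'` (pairing, `exp*`, `log_ω`), and the descent / Galois averaging (`ReciprocityLawDescent`, `…ReciprocityTowerFromAbove`); K★ needs in
addition P1-bar (print) and REC at the ordinary cells. None of that is done here.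

References: [cite: Kato1993LNM1553, Ch. II Thm. 1.4.1 (3)–(4), Lemma 1.4.3] · [cite: BlochKato1990, Ex. 3.10.1, Example 3.11] ·
[cite: SilvermanAEC2009, Thm. IV.6.4, Prop. VII.2.1–VII.2.2, VIII §2].
-/

set_option autoImplicit false
-- single-conjunct summit: `Summit.BirchSwinnertonDyer.BirchSwinnertonDyer.…` repeats the name by design
set_option linter.dupNamespace false

noncomputable section

open Field Function ValuativeRel WittVector NumberField IsDedekindDomain
open scoped NumberField Topology Classical NNReal
open Literature.NumberTheory.PAdicHodge Literature.NumberTheory.GaloisRepresentations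
  Literature.NumberTheory.GaloisRepresentations.IsNonarchimedeanLocalField Literature.NumberTheory.GaloisRepresentations.LubinTate
  Literature.NumberTheory.GaloisCohomology Literature.NumberTheory.EllipticCurves Literature.NumberTheory.EllipticCurves.FormalGroupChart
  Literature.NumberTheory.PAdicHodge.GaloisContinuity Literature.IUT.LogVolume Literature.RingTheory.FormalGroups
  Literature.AlgebraicGeometry.Resolution _root_.WeierstrassCurve

namespace Summit.BirchSwinnertonDyer.BirchSwinnertonDyer.Theorems.TransportedReciprocityAllPoints

variable {K : Type} [Field K] [NumberField K] {p : ℕ} [hprime : Fact p.Prime] (v : HeightOneSpectrum (𝓞 K))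
  [CharZero (v.adicCompletion K)] [LocallyCompactSpace (absoluteGaloisGroup (v.adicCompletion K))]
  [Fact (¬ IsUnit (p : integerC (v.adicCompletion K)))]
  [IsAdicComplete (Ideal.span {(p : integerC (v.adicCompletion K))}) (integerC (v.adicCompletion K))]
  [CharP 𝓀[v.adicCompletion K] p] [CharZero (CompletedAlgClosure (v.adicCompletion K))]
  (hpv : valuation (v.adicCompletion K) (p : v.adicCompletion K) < 1)
  (Dv : EisensteinRoot (v.adicCompletion K) p hpv) (Wm : WeierstrassCurve (EisensteinRoot.CoeffDisc Dv))
  (ψm : EisensteinRoot.CoeffDisc Dv →+* LTCoeff (v.adicCompletion K))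
  (hψm : ∀ c, algebraMap (LTCoeff (v.adicCompletion K)) (v.adicCompletion K) (ψm c) = EisensteinRoot.CoeffDisc.toF Dv c)
  (hp2 : p ≠ 2) (hΔ : IsUnit (Wm.map ψm).Δ) (hA : ((Wm.map ψm).map (AinfTop.redCoeff (v.adicCompletion K))).hasseCoeff p = 0)
  [(AinfTop.curveFO (v.adicCompletion K) (Wm.map ψm)).IsElliptic]
  [(curveOver (CompletedAlgClosure (v.adicCompletion K)) (Wm.map ψm)).IsElliptic]
  (e : (k : ℕ) → geomTorsion (AinfTop.curveFO (v.adicCompletion K) (Wm.map ψm)) ((p ^ k : ℕ) : ℤ) →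
    geomTorsion (AinfTop.curveFO (v.adicCompletion K) (Wm.map ψm)) ((p ^ k : ℕ) : ℤ) → AlgebraicClosure (v.adicCompletion K))
  (hμ : ∀ k S T, e k S T ^ (p ^ k) = 1) (hadd₁ : ∀ k S₁ S₂ T, e k (S₁ + S₂) T = e k S₁ T * e k S₂ T)
  (hadd₂ : ∀ k S T₁ T₂, e k S (T₁ + T₂) = e k S T₁ * e k S T₂)
  (hgal : ∀ k (σ : absoluteGaloisGroup (v.adicCompletion K))
    (S T : geomTorsion (AinfTop.curveFO (v.adicCompletion K) (Wm.map ψm)) ((p ^ k : ℕ) : ℤ)), σ • e k S T = e k (σ • S) (σ • T))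
  (hcompat : ∀ k (S T : geomTorsion (AinfTop.curveFO (v.adicCompletion K) (Wm.map ψm)) ((p ^ (k + 1) : ℕ) : ℤ)),
    e k (torsionMulHom (AinfTop.curveFO (v.adicCompletion K) (Wm.map ψm)) (p ^ (k + 1)) (p ^ k) p (pow_succ p k).symm S)
      (torsionMulHom (AinfTop.curveFO (v.adicCompletion K) (Wm.map ψm)) (p ^ (k + 1)) (p ^ k) p (pow_succ p k).symm T) =
        e (k + 1) S T ^ p)
  -- a valuation of `F = K_v` compatible with its valuative structure, for `log_ω = padicLogPointFiniteExt w E p`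
  (w : Valuation (v.adicCompletion K) ℝ≥0) [w.Compatible] [(AinfTop.curveFO (v.adicCompletion K) (Wm.map ψm)).IsIntegral w.integer]

set_option maxHeartbeats 3200000 in
include hgal hp2 hΔ hA hψm in
/-- ★★★★ **Kato's explicit reciprocity law at EVERY point of `E(F)` for a ramified good supersingular model, from the cells' data and (N1′) alone.**
`F = K_v`; `E = curveFO F (W_D ⊗_ψ 𝒪_F)` good supersingular, `W_D ≡ E₀ (mod ϖ)`, `E₀/ℤ` good supersingular at `p ≥ 5`; an index `N ≥ e`; (N1′)
`∫_τ ω_{W_D} ≠ 0` for some `τ`; the cell data of the socket; `w` a compatible valuation of `F`. Then there is ONE `c ∈ F` such that for every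
`η ∈ Z¹(Γ_F, T_pE)` and EVERY `P ∈ E(F)`: **`⟨[η], P⟩ = Tr_{F/ℚ_p}(c · exp*_d(η) · log_ω(P))`**, `log_ω = padicLogPointFiniteExt w E p` — no division-sequence,
formal-point, depth or chart hypothesis left (T5-C + the chart `AinfTop.algebraMap_pow_mul_padicLogPointFiniteExt_curveFO_eq` on the level + the index step
`ReciprocityFormulaOffLevel.eq_neg_trace_mul_of_forall_level`; `c = −p^N·c_{T5-C}`). [cite: Kato1993LNM1553, Ch. II Thm. 1.4.1 (3)–(4), Lemma 1.4.3]
[cite: BlochKato1990, Ex. 3.10.1, Example 3.11] [cite: SilvermanAEC2009, Thm. IV.6.4, Prop. VII.2.1–VII.2.2] -/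
theorem exists_const_tatePairingPoint_eq_trace_mul_padicLog (hp5 : 5 ≤ p)
    (E₀ : WeierstrassCurve ℤ)
    (hWE : Wm.map (Ideal.Quotient.mk (Ideal.span {EisensteinRoot.CoeffDisc.of Dv (AdjoinRoot.root Dv.poly)})) =
      (E₀.map (algebraMap ℤ (EisensteinRoot.CoeffDisc Dv))).map
        (Ideal.Quotient.mk (Ideal.span {EisensteinRoot.CoeffDisc.of Dv (AdjoinRoot.root Dv.poly)})))
    (hΔ₀ : ¬ (p : ℤ) ∣ E₀.Δ) (hA₀ : (E₀.map (Int.castRingHom (ZMod p))).hasseCoeff p = 0)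
    [(E₀.map (Int.castRingHom ℚ_[p])).IsElliptic] [(E₀.map (Int.castRingHom (ZMod p))).IsElliptic]
    [(curveOver (CompletedAlgClosure (v.adicCompletion K)) E₀).IsElliptic]
    {N : ℕ} (hN : Dv.e ≤ N)
    (hN1' : ∃ τ : AinfTop.TatePtO (v.adicCompletion K) (Wm.map ψm) p,
      AinfRamTop.omegaPeriod Wm (surjective_fontaineTheta_integerC hpv) (AinfTop.seqO (Wm.map ψm) τ) (AinfTop.seqO_zero (Wm.map ψm) τ)
        (AinfRamTop.mulPC_seqO Wm ψm hψm τ) ≠ 0)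
    (ψ : C(absoluteGaloisGroup (v.adicCompletion K), ℤ_[p])) (hψ : ∀ σ τ, ψ (σ * τ) = ψ σ + ψ τ)
    (hψlog : ∀ τ, (ψ τ : ℚ_[p]) = logCyclotomic (F := (v.adicCompletion K)) p τ)
    (heL : ∀ (c : ℤ_[p]) (S U : (AinfTop.curveFO (v.adicCompletion K) (Wm.map ψm)).tateModule p),
      (weilContPairingPadic (AinfTop.curveFO (v.adicCompletion K) (Wm.map ψm)) (v.adicCompletion K) p e hμ hadd₁ hadd₂ hgal hcompat).toLin (c • S) U =
      twistHom (v.adicCompletion K) p ((weilContPairingPadic (AinfTop.curveFO (v.adicCompletion K) (Wm.map ψm)) (v.adicCompletion K) p e hμ hadd₁ hadd₂ hgal hcompat).toLin S U) c)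
    (healt : ∀ S : (AinfTop.curveFO (v.adicCompletion K) (Wm.map ψm)).tateModule p,
      (weilContPairingPadic (AinfTop.curveFO (v.adicCompletion K) (Wm.map ψm)) (v.adicCompletion K) p e hμ hadd₁ hadd₂ hgal hcompat).toLin S S = 0)
    (henondeg : ∀ S : (AinfTop.curveFO (v.adicCompletion K) (Wm.map ψm)).tateModule p,
      (∀ U, (weilContPairingPadic (AinfTop.curveFO (v.adicCompletion K) (Wm.map ψm)) (v.adicCompletion K) p e hμ hadd₁ hadd₂ hgal hcompat).toLin S U = 0) → S = 0)
    (hinj : letI := LocalField.padicAlgebra (v.adicCompletion K) p hpv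
      (bdRPeriodRingData (F := (v.adicCompletion K)) (p := p) hpv).CupLogInjective (logCyclotomic p)
        (restrictedRationalTateRep (AinfTop.curveFO (v.adicCompletion K) (Wm.map ψm)) (v.adicCompletion K) p))
    (hde : letI := LocalField.padicAlgebra (v.adicCompletion K) p hpv
      ∀ η : contOneCocycles (restrictedTateRep (AinfTop.curveFO (v.adicCompletion K) (Wm.map ψm)) (v.adicCompletion K) p).toTopRep,
        (bdRPeriodRingData (F := (v.adicCompletion K)) (p := p) hpv).HasDualExp (logCyclotomic p)
          (restrictedRationalTateRep (AinfTop.curveFO (v.adicCompletion K) (Wm.map ψm)) (v.adicCompletion K) p)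
          fun σ => TateModule.toRational p (η.1 σ))
    (d : letI := LocalField.padicAlgebra (v.adicCompletion K) p hpv
      (bdRPeriodRingData (F := (v.adicCompletion K)) (p := p) hpv).FilZeroLine
        (restrictedRationalTateRep (AinfTop.curveFO (v.adicCompletion K) (Wm.map ψm)) (v.adicCompletion K) p)) :
    letI := LocalField.padicAlgebra (v.adicCompletion K) p hpv
    ∃ c : v.adicCompletion K,
      ∀ (η : contOneCocycles (restrictedTateRep (AinfTop.curveFO (v.adicCompletion K) (Wm.map ψm)) (v.adicCompletion K) p).toTopRep)
        (P : ((AinfTop.curveFO (v.adicCompletion K) (Wm.map ψm)).baseChange (v.adicCompletion K)).toAffine.Point),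
        ((tatePairingPoint (AinfTop.curveFO (v.adicCompletion K) (Wm.map ψm)) (v.adicCompletion K) p e hμ hadd₁ hadd₂ hgal hcompat
            (oneCocycleClass _ η) P : ℤ_[p]) : ℚ_[p]) =
          Algebra.trace ℚ_[p] (v.adicCompletion K)
            (c * expStarCoord (AinfTop.curveFO (v.adicCompletion K) (Wm.map ψm)) hpv d η *
              padicLogPointFiniteExt w (AinfTop.curveFO (v.adicCompletion K) (Wm.map ψm)) p P) := by
  letI := LocalField.padicAlgebra (v.adicCompletion K) p hpv
  -- T5-C: Kato's formula at the deep formal points, free scalar `c_P` (STEPWISE application of the many-binder theorem)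
  have h1 := TransportedReciprocity.exists_const_tatePairingPoint_eq_neg_trace_of_omegaPeriod_ne_zero v hpv Dv Wm ψm hψm hp2 hΔ hA e hμ
    hadd₁ hadd₂ hgal hcompat hp5 E₀ hWE hΔ₀ hA₀ (N := N) hN hN1' ψ hψ hψlog
  have h2 := h1 heL healt henondeg
  obtain ⟨c₀, hc₀⟩ := h2 hinj hde d
  clear h1 h2
  refine ⟨-((p : v.adicCompletion K) ^ N * c₀), fun η P => ?_⟩
  have hp0 : (p : v.adicCompletion K) ≠ 0 := Nat.cast_ne_zero.2 hprime.out.ne_zero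
  have hpw : w (p : v.adicCompletion K) < 1 := (ValuativeRel.isEquiv w (valuation (v.adicCompletion K))).lt_one_iff_lt_one.mpr hpv
  have hℓ := limitLog_spec_of_isNonarchimedeanLocalField (AinfTop.curveFO (v.adicCompletion K) (Wm.map ψm)) w hp0 hpv
  have hN0 : N ≠ 0 := (Nat.lt_of_lt_of_le Dv.e_pos hN).ne'
  -- every point has a positive multiple in the level
  obtain ⟨m, hm, hmP⟩ := exists_nsmul_mem_level_of_isNonarchimedeanLocalField (AinfTop.curveFO (v.adicCompletion K) (Wm.map ψm)) w hp0
    (P : (AinfTop.curveFO (v.adicCompletion K) (Wm.map ψm)).toAffine.Point)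
  -- the formula ON the level, with `c_Q := p^N · log_ω Q` (chart) and a division sequence of `Q`
  have hlevel : ∀ Q ∈ level w (AinfTop.curveFO (v.adicCompletion K) (Wm.map ψm)) (w (p : v.adicCompletion K)),
      ((tatePairingPoint (AinfTop.curveFO (v.adicCompletion K) (Wm.map ψm)) (v.adicCompletion K) p e hμ hadd₁ hadd₂ hgal hcompat
          (oneCocycleClass _ η) Q : ℤ_[p]) : ℚ_[p]) =
        -Algebra.trace ℚ_[p] (v.adicCompletion K)
          ((p : v.adicCompletion K) ^ N * (expStarCoord (AinfTop.curveFO (v.adicCompletion K) (Wm.map ψm)) hpv d η * c₀) *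
            padicLogPointFiniteExt w (AinfTop.curveFO (v.adicCompletion K) (Wm.map ψm)) p Q) := by
    intro Q hQ
    obtain ⟨Qs, hQs0, hQs⟩ := AinfTop.exists_divSeqO (Wm.map ψm) (p := p) (toGeomPoints (AinfTop.curveFO (v.adicCompletion K) (Wm.map ψm)) Q)
    have hker : AinfTop.geomToCO (Wm.map ψm) (Qs 0) ∈ kernel (NormedField.valuation (K := CompletedAlgClosure (v.adicCompletion K)))
        (curveOver (CompletedAlgClosure (v.adicCompletion K)) (Wm.map ψm)) := by
      rw [hQs0]; exact AinfTop.geomToCO_toGeomPoints_mem_kernel _ w hQ.1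
    have hz : ((zPt (AinfTop.geomToCO (Wm.map ψm) (Qs 0)) hker : CBall (v.adicCompletion K)) : CompletedAlgClosure (v.adicCompletion K)) =
        (AinfTop.geomToCO (Wm.map ψm) (toGeomPoints (AinfTop.curveFO (v.adicCompletion K) (Wm.map ψm)) Q)).zCoord := by
      rw [coe_zPt, hQs0]
    have hdepth : ‖((zPt (AinfTop.geomToCO (Wm.map ψm) (Qs 0)) hker : CBall (v.adicCompletion K)) : CompletedAlgClosure (v.adicCompletion K))‖ ^ N ≤
        ‖(p : CompletedAlgClosure (v.adicCompletion K))‖ := by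
      rw [hz]; exact AinfTop.norm_zCoord_geomToCO_toGeomPoints_pow_le (Wm.map ψm) hpv w hQ hN0
    have hcP : algebraMap (v.adicCompletion K) (CompletedAlgClosure (v.adicCompletion K))
        ((p : v.adicCompletion K) ^ N * padicLogPointFiniteExt w (AinfTop.curveFO (v.adicCompletion K) (Wm.map ψm)) p Q) =
        (p : CompletedAlgClosure (v.adicCompletion K)) ^ N *
          ∑' j : ℕ, PowerSeries.coeff j (Wm.map ((CBall (v.adicCompletion K)).subtype.comp (EisensteinRoot.CoeffDisc.toCBall Dv))).formalLog *
            ((zPt (AinfTop.geomToCO (Wm.map ψm) (Qs 0)) hker : CBall (v.adicCompletion K)) : CompletedAlgClosure (v.adicCompletion K)) ^ j := by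
      rw [hz]; exact AinfTop.algebraMap_pow_mul_padicLogPointFiniteExt_curveFO_eq Dv Wm ψm hψm w hQ N
    have hmain := hc₀ η Q Qs hQs hQs0 hker hdepth _ hcP
    rw [hmain, mul_assoc, mul_comm (padicLogPointFiniteExt w _ p Q), ← mul_assoc]
  -- off the level
  have key := eq_neg_trace_mul_of_forall_level w (AinfTop.curveFO (v.adicCompletion K) (Wm.map ψm)) hp0 hpw hℓ
    (tatePairingPoint (AinfTop.curveFO (v.adicCompletion K) (Wm.map ψm)) (v.adicCompletion K) p e hμ hadd₁ hadd₂ hgal hcompat (oneCocycleClass _ η))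
    ((p : v.adicCompletion K) ^ N * (expStarCoord (AinfTop.curveFO (v.adicCompletion K) (Wm.map ψm)) hpv d η * c₀)) hlevel hm hmP
  -- `key` speaks of `P` as a point of `E` (= `E.baseChange F` definitionally): close by `trans` (defeq), not `rw`
  refine key.trans ?_
  rw [← map_neg]
  congr 1
  ring

end Summit.BirchSwinnertonDyer.BirchSwinnertonDyer.Theorems.TransportedReciprocityAllPoints

end
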